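import Summits.Ventures.HodgeRepro2.T5HermitianGlobalChain
import Summits.Ventures.HodgeRepro2.T5DatumSimilitude

/-!
# Congruence of Gram matrices ⟺ isometry of the sesquilinear forms — the bridge between file 156's chain and
seat t6-p5's display shape (cell pub-hodge-repro2, seat p3)

Tier-5 N2 support, row N2.8.1 (iii) / Lemma N.1 («W₁₂ ≅ W₃₄»). File 156 states the global chain on Gram matrices
(`IsCongruent H H'`, file 134: `∃ P, IsUnit P.det ∧ Pᴴ * H * P = H'`); seat t6-p5's display
`T6.Hyp.Shimura2008_Thm2_2_i K` and the N2 datum (file 53) speak of the rank-2 forms `pairForm c₁ c₂` on `K × K`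
(`v.1 · star w.1 · c₁ + v.2 · star w.2 · c₂`, Shimura's (1.2) convention) and of an isometry
`g : K × K ≃ₗ[K] K × K` with `pairForm c₁' c₂' (g v) (g w) = pairForm c₁ c₂ v w`. This file makes the two readings
interchangeable, over any field with involution:

* `sesqForm H v w := v ⬝ᵥ (H *ᵥ star w)` — the sesquilinear form of a Gram matrix (linear in `v`, anti-linear in
  `w`; file 82's rank-2 `gramForm` is the conjugate convention); `sesqForm_single`: its Gram matrix is `H` again;
* `sesqForm_conjTranspose_mul_mul`: `sesqForm (Pᴴ H P) v w = sesqForm H (P̄ v) (P̄ w)` — the change of basis;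
* **`exists_linearEquiv_of_isCongruent`** / **`isCongruent_of_exists_linearEquiv`**: `IsCongruent H H'` iff some
  linear automorphism `g` of `n → E` has `sesqForm H (g v) (g w) = sesqForm H' v w` for all `v, w`;
* `pairForm_finTwoArrow`: `pairForm c₁ c₂` is `sesqForm (diagonal ![c₁, c₂])` along `Fin 2 → E ≃ E × E`;
* **`exists_isometry_pairForm_of_isCongruent`** / **`isCongruent_diagonal_of_exists_isometry_pairForm`**: the
  rank-2 diagonal case in t6-p5's exact shape;
* **`exists_isometry_pairForm_of_chain`**: file 156's global chain concluded in that shape — for the datum's two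
  diagonal forms, `hodd` + equal signatures + `|D| ≤ 1` + `OMeara1963_71_18 K⁺` + `GrossBH2021_Thm3_1_uniqueness`
  give the isometry `g` of Lemma N.1.

Mathlib + this seat's files 53 / 134 / 156 and their imports; no display; no device.
§8(d): uses an L-value-free non-vanishing device: NO.
-/

namespace Summit.Ventures.HodgeRepro2.T5GramIsometry

open Matrix
open Summit.Ventures.HodgeRepro2.T5HermitianDetClass Summit.Ventures.HodgeRepro2.T5DatumSimilitude

section Gram

variable {E : Type*} [CommRing E] [StarRing E] {n : Type*} [Fintype n] [DecidableEq n]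

/-- The sesquilinear form of a Gram matrix: `sesqForm H v w = Σ_{i j} v i · H i j · star (w j)` (linear in `v`,
anti-linear in `w` — Shimura's (1.2) convention, the one of file 53's `pairForm`). NOT file 82's
`T5SplitHermitianPlane.gramForm` (rank 2, `star v ⬝ H w`: anti-linear in the FIRST slot). -/
def sesqForm (H : Matrix n n E) (v w : n → E) : E := v ⬝ᵥ (H *ᵥ star w)

omit [DecidableEq n] in
/-- `P *ᵥ star v = star (P̄ *ᵥ v)`, `P̄ = P.map star`. -/
theorem mulVec_star_eq (P : Matrix n n E) (v : n → E) : P *ᵥ star v = star ((P.map star) *ᵥ v) := by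
  ext i
  simp only [mulVec, dotProduct, Pi.star_apply, star_sum, star_mul, star_star, Matrix.map_apply]
  exact Finset.sum_congr rfl fun j _ => mul_comm _ _

omit [DecidableEq n] in
/-- **The change of basis:** `sesqForm (Pᴴ H P) v w = sesqForm H (P̄ v) (P̄ w)`. -/
theorem sesqForm_conjTranspose_mul_mul (P H : Matrix n n E) (v w : n → E) :
    sesqForm (Pᴴ * H * P) v w = sesqForm H ((P.map star) *ᵥ v) ((P.map star) *ᵥ w) := by
  unfold sesqForm
  rw [← mulVec_mulVec, ← mulVec_mulVec, dotProduct_mulVec, vecMul_conjTranspose, mulVec_star_eq, star_star,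
    mulVec_star_eq]

/-- The Gram matrix of `sesqForm H` is `H`: `sesqForm H (e i) (e j) = H i j`. -/
theorem sesqForm_single (H : Matrix n n E) (i j : n) :
    sesqForm H (Pi.single i 1) (Pi.single j 1) = H i j := by
  unfold sesqForm
  have hs : star (Pi.single j (1 : E) : n → E) = Pi.single j 1 := by
    ext k
    by_cases h : k = j
    · subst h; simp
    · simp [h]
  rw [hs, mulVec_single_one, single_one_dotProduct]
  rfl

/-- `det (P̄) = star (det P)`. -/
theorem det_map_star (P : Matrix n n E) : (P.map star).det = star P.det := by
  rw [← conjTranspose_transpose, det_transpose, det_conjTranspose]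

/-- **Congruent Gram matrices have isometric forms:** `IsCongruent H H'` gives a linear automorphism `g` with
`sesqForm H (g v) (g w) = sesqForm H' v w` (`g = P̄`). -/
theorem exists_linearEquiv_of_isCongruent {H H' : Matrix n n E} (h : IsCongruent H H') :
    ∃ g : (n → E) ≃ₗ[E] (n → E), ∀ v w, sesqForm H (g v) (g w) = sesqForm H' v w := by
  obtain ⟨P, hP, rfl⟩ := h
  have hP' : IsUnit (P.map star).det := by rw [det_map_star]; exact isUnit_star.mpr hP
  refine ⟨(P.map star).toLinearEquiv' (Matrix.invertibleOfIsUnitDet _ hP'), fun v w => ?_⟩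
  rw [sesqForm_conjTranspose_mul_mul]
  rfl

/-- **Isometric forms have congruent Gram matrices:** a linear automorphism `g` with
`sesqForm H (g v) (g w) = sesqForm H' v w` gives `IsCongruent H H'` (`P = Ḡ`, `G` the matrix of `g`). -/
theorem isCongruent_of_exists_linearEquiv {H H' : Matrix n n E}
    (h : ∃ g : (n → E) ≃ₗ[E] (n → E), ∀ v w, sesqForm H (g v) (g w) = sesqForm H' v w) :
    IsCongruent H H' := by
  obtain ⟨g, hg⟩ := h
  set G : Matrix n n E := LinearMap.toMatrix' (g : (n → E) →ₗ[E] (n → E)) with hG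
  have hGdet : IsUnit G.det := by
    rw [hG, LinearMap.det_toMatrix']
    exact LinearEquiv.isUnit_det' g
  refine ⟨G.map star, by rw [det_map_star]; exact isUnit_star.mpr hGdet, ?_⟩
  ext i j
  rw [← sesqForm_single (_ * H * _) i j, sesqForm_conjTranspose_mul_mul, ← sesqForm_single H' i j, ← hg]
  have hGG : (G.map star).map star = G := by ext; simp
  rw [hGG]
  simp only [hG, LinearMap.toMatrix'_mulVec, LinearEquiv.coe_coe]

end Gram

section Diagonal

variable {E : Type*} [Field E] [StarRing E]

/-- `pairForm c₁ c₂` is the form of the Gram matrix `diagonal ![c₁, c₂]`, along `Fin 2 → E ≃ E × E`. -/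
theorem pairForm_finTwoArrow (c₁ c₂ : E) (v w : Fin 2 → E) :
    pairForm c₁ c₂ (LinearEquiv.finTwoArrow E E v) (LinearEquiv.finTwoArrow E E w) =
      sesqForm (diagonal ![c₁, c₂]) v w := by
  unfold sesqForm pairForm lineForm
  simp only [LinearEquiv.finTwoArrow_apply, dotProduct, Fin.sum_univ_two, mulVec_diagonal, Pi.star_apply,
    Matrix.cons_val_zero, Matrix.cons_val_one]
  ring

/-- **The rank-2 diagonal case in seat t6-p5's shape:** `IsCongruent (diagonal ![c₁', c₂']) (diagonal ![c₁, c₂])`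
gives `g : E × E ≃ₗ[E] E × E` with `pairForm c₁' c₂' (g v) (g w) = pairForm c₁ c₂ v w`. -/
theorem exists_isometry_pairForm_of_isCongruent {c₁ c₂ c₁' c₂' : E}
    (h : IsCongruent (diagonal ![c₁', c₂']) (diagonal ![c₁, c₂])) :
    ∃ g : (E × E) ≃ₗ[E] (E × E), ∀ v w, pairForm c₁' c₂' (g v) (g w) = pairForm c₁ c₂ v w := by
  obtain ⟨g₀, hg₀⟩ := exists_linearEquiv_of_isCongruent h
  refine ⟨((LinearEquiv.finTwoArrow E E).symm.trans g₀).trans (LinearEquiv.finTwoArrow E E), fun v w => ?_⟩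
  simp only [LinearEquiv.trans_apply]
  rw [pairForm_finTwoArrow, hg₀, ← pairForm_finTwoArrow, LinearEquiv.apply_symm_apply,
    LinearEquiv.apply_symm_apply]

/-- **Conversely**, an isometry of the two `pairForm`s gives the congruence of the diagonal Gram matrices. -/
theorem isCongruent_diagonal_of_exists_isometry_pairForm {c₁ c₂ c₁' c₂' : E}
    (h : ∃ g : (E × E) ≃ₗ[E] (E × E), ∀ v w, pairForm c₁' c₂' (g v) (g w) = pairForm c₁ c₂ v w) :
    IsCongruent (diagonal ![c₁', c₂']) (diagonal ![c₁, c₂]) := by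
  obtain ⟨g, hg⟩ := h
  refine isCongruent_of_exists_linearEquiv
    ⟨((LinearEquiv.finTwoArrow E E).trans g).trans (LinearEquiv.finTwoArrow E E).symm, fun v w => ?_⟩
  simp only [LinearEquiv.trans_apply]
  rw [← pairForm_finTwoArrow, LinearEquiv.apply_symm_apply, LinearEquiv.apply_symm_apply, hg,
    pairForm_finTwoArrow]

end Diagonal

section Chain

open IsDedekindDomain IsDedekindDomain.HeightOneSpectrum NumberField NumberField.IsCMField
open Summit.Ventures.HodgeRepro2.T5HermitianGlobalChain

variable {K : Type*} [Field K] [NumberField K] [IsCMField K]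
variable {θ : maximalRealSubfield K} {y : K}
  (hθ : algebraMap (maximalRealSubfield K) K θ = y ^ 2) (hy : complexConj K y ≠ y)

include hθ hy in
/-- **File 156's global chain in seat t6-p5's shape — Lemma N.1's isometry `W₁₂ ≅ W₃₄`:** for two rank-2 diagonal
hermitian forms `pairForm c₁ c₂`, `pairForm c₁' c₂'` over the CM field `K` (`star cᵢ = cᵢ`, `cᵢ ≠ 0`), the
selection-rule input `hodd` at the odd non-split places, equal signatures `hreal`, `|D| ≤ 1`, Hilbert reciprocity
(t6-p4's display) and Landherr's uniqueness (file 156's display) give `g : K × K ≃ₗ[K] K × K` with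
`pairForm c₁' c₂' (g v) (g w) = pairForm c₁ c₂ v w`. -/
theorem exists_isometry_pairForm_of_chain {c₁ c₂ c₁' c₂' : K}
    (h₁ : star c₁ = c₁) (h₂ : star c₂ = c₂) (h₁' : star c₁' = c₁') (h₂' : star c₂' = c₂')
    (hc₁ : c₁ ≠ 0) (hc₂ : c₂ ≠ 0) (hc₁' : c₁' ≠ 0) (hc₂' : c₂' ≠ 0)
    (hodd : ∀ v : HeightOneSpectrum (𝓞 (maximalRealSubfield K)),
      ¬ IsSquare (algebraMap (maximalRealSubfield K) (v.adicCompletion (maximalRealSubfield K)) θ) →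
      IsUnit (2 : adicCompletionIntegers (maximalRealSubfield K) v) →
      LocallyCongruent K v (diagonal ![c₁', c₂']) (diagonal ![c₁, c₂]))
    (hreal : ∀ φ : K →+* ℂ,
      IsCongruent ((diagonal ![c₁', c₂']).map φ) ((diagonal ![c₁, c₂]).map φ))
    (hD : (dyadicNonSplit K (θ := θ)).Subsingleton)
    (hrec : Summit.Ventures.HodgeRepro2.T6.Hyp.OMeara1963_71_18 (maximalRealSubfield K))
    (hLandherr : GrossBH2021_Thm3_1_uniqueness K (Fin 2)) :
    ∃ g : (K × K) ≃ₗ[K] (K × K), ∀ v w, pairForm c₁' c₂' (g v) (g w) = pairForm c₁ c₂ v w := by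
  have hH : (diagonal ![c₁', c₂']).IsHermitian := by
    refine isHermitian_diagonal_iff.mpr fun i => ?_
    fin_cases i
    · exact h₁'
    · exact h₂'
  have hH' : (diagonal ![c₁, c₂]).IsHermitian := by
    refine isHermitian_diagonal_iff.mpr fun i => ?_
    fin_cases i
    · exact h₁
    · exact h₂
  have hdet : IsUnit (diagonal ![c₁', c₂']).det := by
    rw [det_diagonal, Fin.prod_univ_two]
    simp [hc₁', hc₂']
  have hdet' : IsUnit (diagonal ![c₁, c₂]).det := by
    rw [det_diagonal, Fin.prod_univ_two]
    simp [hc₁, hc₂]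
  exact exists_isometry_pairForm_of_isCongruent
    (isCongruent_of_chain hθ hy hH hH' hdet hdet' hodd hreal hD hrec hLandherr)

end Chain

end Summit.Ventures.HodgeRepro2.T5GramIsometry
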